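import Literature.NumberTheory.EllipticCurves.CMNewformGamma0NebentypusProofs
import Literature.NumberTheory.EllipticCurves.CMNewformGamma0OfGrossencharakter
import Literature.NumberTheory.EllipticCurves.CMNewformHeckeEigenformProofs
import Literature.NumberTheory.EllipticCurves.MurtySinhaMultiplicityHeckeProofs
import Literature.NumberTheory.EllipticCurves.NewformsProofs
import Literature.NumberTheory.ModularForms.QExpansionDerivative
import Literature.NumberTheory.Automorphic.CDTTheorem722SerreProofs
import Literature.NumberTheory.Automorphic.LanglandsTunnellLSeriesProofs
import Literature.NumberTheory.Automorphic.Sweep1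
import HarnessLib

/-!
# Ribet's `Γ₀` CM-newform theorem (LNM 601 §3, trivial Nebentypus) at every weight `k ≥ 2` from ONE
# printed input: the weight-`k` Hecke theta cusp form (proofs only)

Topic `NumberTheory/EllipticCurves`; namespace `Literature.NumberTheory.EllipticCurves.ModularForms`.
Second sibling proof file of `CMNewformGamma0OfGrossencharakter.lean` (named fact
`Ribet1977_cmNewform_gamma0_of_isGrossencharakter`: Ribet, LNM 601 (1977), §3, Thm. (3.4) and
Cor. (3.5), pp. 34–35, case `ε = 1`).  THEOREMS ONLY — no definition, no named fact (D-0026).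

Ribet's printed proof of Thm. (3.4) is one sentence: "The following result is [25, Lemma 3]; see
also [7, p. 717]" — [25] = Shimura, *On elliptic curves with complex multiplication as factors of the
Jacobians of modular function fields*, Nagoya Math. J. 43 (1971), Lemma 3 (`f_λ ∈ S_{ν+1}(D·N(𝔪), ε)`,
proved there by Weil's converse theorem for primitive `λ` and induction on `N(𝔠⁻¹𝔪)`), [7] = Hecke,
*Werke* (theta series with the spherical polynomial `σ(x)^{k-1}`).  Everything AFTER that sentence is
formal and is kernel-checked here at every weight `k ≥ 2` (the character bookkeeping is the sibling
`CMNewformGamma0NebentypusProofs.lean`):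

* **`ribet1977_cmNewform_gamma0_of_heckeThetaCuspForm`** — for ONE datum `(K, σ, k, 𝔪, ψ)`: IF the
  series `Σ_{(𝔞,𝔪)=1} ψ̃(𝔞) q^{N𝔞}` is (the `q`-expansion of) a cusp form in `S_k(Γ₀(|d_K|·N𝔪))` —
  Thm. (3.4), first sentence, with `ε = ηφ = 1` — THEN the conclusion of the fact holds for that datum:
  a level `N ∣ |d_K|·N𝔪` and a newform `g ∈ S_k(Γ₀(N))` (`exists_isNewform1_of_cm_qExpansion`:
  `T_p`-eigen from the `q`-expansion + Atkin–Lehner–Li; descent `Γ₁ → Γ₀` for trivial character,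
  `BCDT.exists_isNewform0_coe_eq_of_nebentypus_eq_one`) with CM by the Kronecker character `κ` and
  `a_p(g) = Σ_{N𝔭 = p} ψ(𝔭)` for `p ∤ |d_K|·N𝔪`;
* **`Ribet1977_cmNewform_gamma0_of_isGrossencharakter_of_heckeTheta`** — the fact VERBATIM from the
  single remaining input, one instance per EVEN weight `k ≥ 2` (odd `k` cannot occur:
  `even_weight_of_trivial_nebentypus`): *the weight-`k` Hecke theta series of a Größencharakter with
  trivial Nebentypus is a cusp form on `Γ₀(|d_K|·N𝔪)` with the displayed `q`-expansion* (Hecke 1926 §3 /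
  Schoeneberg 1939; Shimura 1971, Lemma 3; Miyake, Thm. 4.8.2).  The input is stated inline as a
  hypothesis — no new named fact.  Its `k = 2` instance is PROVED in the tree, Summit-side
  (`Summit.…Theorems.HeckeTheta.exists_heckeTheta_cuspForm`, Hecke's theta series from the gradient of
  the genus-two Riemann theta function; route `ResidualThetaTransportAtTwo`, which also has the `k = 2`
  slice of the fact as `HeckeTheta.ribet_cmNewform_gamma0_two`); Literature cannot import it, so here
  `k = 2` stays part of the hypothesis.

HONESTY.  The named fact is NOT discharged by this file: it is reduced to the displayed input for even
`k ≥ 2` (for `k ≥ 4` the tree has no weight-`k` theta series: its weight-two machinery uses ONE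
derivative of the theta null, weight `k` needs the `(k-1)`-st derivative along the isotropic line of
`σ`, or Weil's converse theorem).  No summit statement (BirchSwinnertonDyer) is proved by this file.

## References

* K. A. Ribet, *Galois representations attached to eigenforms with Nebentypus*, LNM 601 (1977), §3,
  Thm. (3.4), Cor. (3.5), pp. 34–35. [Ribet1977Nebentypus]
* G. Shimura, Nagoya Math. J. 43 (1971), 199–208, Lemma 3. [Shimura1971CMFactorsJacobians]
* E. Hecke, Math. Ann. 97 (1927). [Hecke1927]
* T. Miyake, *Modular Forms* (1989/2006), Thm. 4.8.2. [Miyake2006]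
-/

set_option autoImplicit false

noncomputable section

open scoped NumberField ComplexConjugate Real MatrixGroups UpperHalfPlane ModularForm nonZeroDivisors
open NumberField Module Complex Filter IsDedekindDomain CongruenceSubgroup
open UpperHalfPlane hiding I

namespace Literature.NumberTheory.EllipticCurves.ModularForms

open Literature.NumberTheory.LFunctions (idealPow rayClassCoeff idealPow_top)
open Literature.NumberTheory.GaloisRepresentations (IsGrossencharakter embType embTypeConj
  prod_embedding_zpow_embType)
open Literature.NumberTheory.Automorphic (IsCMForm)

variable {K : Type} [Field K] [NumberField K]

/-! ### The fact at weight `k` from the weight-`k` Hecke theta cusp form -/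

/-- **Ribet 1977, §3, Thm. (3.4) + Cor. (3.5) with trivial Nebentypus, at weight `k`, FROM the
weight-`k` Hecke theta cusp form.**  For ONE datum — `K` imaginary quadratic, `σ : K → ℂ`, `k ≥ 2`,
`𝔪 ≠ 0`, `ψ` the prime values of a Größencharakter mod `𝔪` of type `σ^{k-1}` with
`ψ̃((n)) = (d_K/n) n^{k-1}` for odd `n` prime to `|d_K| N𝔪` — ASSUME the first sentence of Thm. (3.4)
for it: "the series `g = Σ_{(𝔞,𝔪)=1} ψ(𝔞) q^{N𝔞}` is a cusp form of weight `k` and character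
`ε (= ηφ = 1)`", i.e. some `g ∈ S_k(Γ₀(|d_K|·N𝔪))` has `g(τ) = Σ_n (Σ_{N𝔞 = n} ψ̃_𝔪(𝔞)) qⁿ` (`Θ`).
THEN: there are a level `N ∣ |d_K|·N𝔪` and a newform `g ∈ S_k(Γ₀(N))` with complex multiplication
(by the Kronecker character `κ` of `K`) whose `p`-th coefficient is `Σ_{N𝔭 = p} ψ(𝔭)` for every prime
`p ∤ |d_K|·N𝔪` — the conclusion of `Ribet1977_cmNewform_gamma0_of_isGrossencharakter` for that datum.
Proof as printed (Cor. (3.5): "results from the general theory of newforms"): the tree's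
`exists_isNewform1_of_cm_qExpansion` (`T_p g = a_p g` from the `q`-expansion, Atkin–Lehner–Li packet
theorem), `ε = 1` (lift of a `Γ₀`-form) and the descent `Γ₁ → Γ₀`
(`BCDT.exists_isNewform0_coe_eq_of_nebentypus_eq_one`); "`a_p = 0` if `φ(p) = -1`, so that `f` has
complex multiplication by `φ`" (no ideal of norm `p` at an inert `p`).  Verbatim the proof of the
Summit-side weight-two theorem `HeckeTheta.ribet_cmNewform_gamma0_two` (route
`ResidualThetaTransportAtTwo`) with `2 ↦ k`.
[cite: Ribet1977Nebentypus, §3, Thm. (3.4) and Cor. (3.5) (LNM 601, pp. 34–35)] -/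
theorem ribet1977_cmNewform_gamma0_of_heckeThetaCuspForm (K : Type) [Field K] [NumberField K]
    (hK : finrank ℚ K = 2) (htc : IsTotallyComplex K) (σ : K →+* ℂ) (k : ℕ) (hk : 2 ≤ k)
    (𝔪 : Ideal (𝓞 K)) (h𝔪 : 𝔪 ≠ ⊥) (ψ : HeightOneSpectrum (𝓞 K) → ℂ)
    (hψG : IsGrossencharakter 𝔪 (fun w => ((k : ℤ) - 1) * embType σ w)
      (fun w => ((k : ℤ) - 1) * embTypeConj σ w) ψ)
    (hneb : ∀ n : ℕ, Odd n → n.Coprime ((discr K).natAbs * Ideal.absNorm 𝔪) →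
      idealPow K ψ (Ideal.span {(n : 𝓞 K)}) = (jacobiSym (discr K) n : ℂ) * (n : ℂ) ^ (k - 1))
    (Θ : ∃ g : CuspForm (Gamma0 ((discr K).natAbs * Ideal.absNorm 𝔪)) (k : ℤ), ∀ τ : ℍ,
      HasSum (fun n : ℕ => (∑ᶠ J ∈ {J : Ideal (𝓞 K) | Ideal.absNorm J = n}, rayClassCoeff 𝔪 ψ J) *
        cexp (2 * π * I * (τ : ℂ)) ^ n) (g τ)) :
    ∃ (N : ℕ) (_ : NeZero N) (g : CuspForm (Gamma0 N) (k : ℤ)),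
      N ∣ (discr K).natAbs * Ideal.absNorm 𝔪 ∧ IsNewform0 g ∧ IsCMForm (liftToGamma1 N (k : ℤ) g) ∧
      ∀ p : ℕ, p.Prime → ¬ p ∣ (discr K).natAbs * Ideal.absNorm 𝔪 →
        cuspCoeff g p = ∑ᶠ (v : HeightOneSpectrum (𝓞 K)) (_ : Ideal.absNorm v.asIdeal = p), ψ v := by
  classical
  haveI := htc
  haveI : NeZero (discr K).natAbs := ⟨Int.natAbs_ne_zero.mpr (NumberField.discr_ne_zero K)⟩
  have hM : Ideal.absNorm 𝔪 ≠ 0 := by rw [Ne, Ideal.absNorm_eq_zero_iff]; exact h𝔪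
  haveI hN₀ : NeZero ((discr K).natAbs * Ideal.absNorm 𝔪) := ⟨mul_ne_zero (NeZero.ne _) hM⟩
  have hk1 : 1 ≤ k := by omega
  have hzpow : ∀ x : ℂ, x ^ ((k : ℤ) - 1) = x ^ (k - 1) := fun x => by
    rw [show ((k : ℤ) - 1) = ((k - 1 : ℕ) : ℤ) by omega, zpow_natCast]
  -- the Kronecker character and `ψ̃((m)) = κ(m) m^{k-1}`
  obtain ⟨κ, hprim, hodd, hquad, hκJ, hζ⟩ := exists_kroneckerChar_odd_jacobiSym_dedekindZeta (K := K) hK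
  have hηκ : ∀ m : ℕ, m.Coprime ((discr K).natAbs * Ideal.absNorm 𝔪) →
      idealPow K ψ (Ideal.span {(m : 𝓞 K)}) = κ m * (m : ℂ) ^ (k - 1) := fun m hm =>
    idealPow_span_natCast_eq_kroneckerChar_mul_pow hK σ hk1 hκJ hψG hneb hm
  -- the theta series
  set N₀ : ℕ := (discr K).natAbs * Ideal.absNorm 𝔪 with hN₀def
  obtain ⟨g₀, hg₀⟩ := Θ
  set g₁ : CuspForm (Gamma1 N₀) (k : ℤ) := liftToGamma1 N₀ (k : ℤ) g₀ with hg₁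
  have hcoe₁ : (⇑g₁ : ℍ → ℂ) = ⇑g₀ := coe_liftToGamma1_holds N₀ (k : ℤ) g₀
  have hgχ : g₁ ∈ nebentypusSubspace N₀ (k : ℤ) 1 :=
    MurtySinha.liftToGamma1_mem_nebentypusSubspace_one N₀ (k : ℤ) g₀
  -- the `q`-expansion
  have hq : ∀ n : ℕ, (qExpansion 1 ⇑g₁).coeff n =
      ∑ᶠ I ∈ {I : Ideal (𝓞 K) | Ideal.absNorm I = n}, rayClassCoeff 𝔪 ψ I := by
    intro n
    refine Literature.NumberTheory.ModularForms.qExpansion_coeff_eq_of_hasSum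
      (c := fun n => ∑ᶠ I ∈ {I : Ideal (𝓞 K) | Ideal.absNorm I = n}, rayClassCoeff 𝔪 ψ I)
      (SlashInvariantFormClass.periodic_comp_ofComplex g₁ (HeckeTGamma1.one_mem_strictPeriods_Gamma1 N₀))
      (ModularFormClass.holo g₁) (ModularFormClass.bdd_at_infty g₁) (fun τ => ?_) n
    rw [hcoe₁]
    refine (hg₀ τ).congr_fun fun m => ?_
    rw [smul_eq_mul, Function.Periodic.qParam]
    congr 2
    push_cast
    ring_nf
  have hq' : ∀ n : ℕ, 0 < n → (qExpansion 1 ⇑g₁).coeff n =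
      ∑ᶠ I ∈ {I : Ideal (𝓞 K) | Ideal.absNorm I = n}, rayClassCoeff 𝔪 ψ I := fun n _ => hq n
  have hg0 : g₁ ≠ 0 := by
    intro h
    have h1 := hq 1
    rw [h] at h1
    have hset : {I : Ideal (𝓞 K) | Ideal.absNorm I = 1} = {⊤} := by
      ext I; simp [Ideal.absNorm_eq_one_iff]
    rw [hset, finsum_mem_singleton, rayClassCoeff_top] at h1
    have : (qExpansion 1 (⇑(0 : CuspForm (Gamma1 N₀) (k : ℤ)))).coeff 1 = 0 := by
      rw [CuspForm.coe_zero, UpperHalfPlane.qExpansion_zero]; simp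
    rw [this] at h1
    exact zero_ne_one h1
  -- places over primes away from the level
  have hunr : ∀ v : HeightOneSpectrum (𝓞 ℚ), ¬ Rat.HeightOneSpectrum.natGenerator v ∣ N₀ →
      v.asIdeal.ramificationIdxIn (𝓞 K) = 1 := fun v hv =>
    ramificationIdxIn_eq_one_of_not_dvd_level K v (dvd_mul_right _ _) hv
  have hwv : ∀ {v : HeightOneSpectrum (𝓞 ℚ)} {w : HeightOneSpectrum (𝓞 K)},
      w.asIdeal.under (𝓞 ℚ) = v.asIdeal → w.under (𝓞 ℚ) = v := fun hw =>
    HeightOneSpectrum.ext (by rw [HeightOneSpectrum.under_asIdeal]; exact hw)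
  have hcop : ∀ v : HeightOneSpectrum (𝓞 ℚ), ¬ Rat.HeightOneSpectrum.natGenerator v ∣ N₀ →
      ∀ w : HeightOneSpectrum (𝓞 K), w.asIdeal.under (𝓞 ℚ) = v.asIdeal → IsCoprime w.asIdeal 𝔪 := by
    intro v hv w hw
    rw [Ideal.isCoprime_iff_sup_eq]
    by_contra hne
    have hle : 𝔪 ≤ w.asIdeal := by
      have hmax := w.isMaximal
      rcases hmax.eq_of_le (J := w.asIdeal ⊔ 𝔪) (fun h => hne h) le_sup_left with h
      exact h ▸ le_sup_right
    have hdvd : Ideal.absNorm w.asIdeal ∣ Ideal.absNorm 𝔪 := Ideal.absNorm_dvd_absNorm_of_le hle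
    have hp : Rat.HeightOneSpectrum.natGenerator v ∣ Ideal.absNorm w.asIdeal := by
      rw [absNorm_asIdeal_eq_natGenerator_pow, hwv hw]
      exact dvd_pow_self _ (Ideal.inertiaDeg_pos (R := 𝓞 ℚ) (q := w.asIdeal)).ne'
    exact hv ((hp.trans hdvd).trans (dvd_mul_left _ _))
  -- `ψ̃((p)) = κ(p) p^{k-1}`, `κ(p) = ±1` according to the splitting of `p`
  have hψp : ∀ v : HeightOneSpectrum (𝓞 ℚ), ¬ Rat.HeightOneSpectrum.natGenerator v ∣ N₀ →
      idealPow K ψ (Ideal.span {((Rat.HeightOneSpectrum.natGenerator v : ℕ) : 𝓞 K)}) =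
        κ (Rat.HeightOneSpectrum.natGenerator v) *
          (Rat.HeightOneSpectrum.natGenerator v : ℂ) ^ (k - 1) := fun v hv =>
    hηκ _ ((Nat.Prime.coprime_iff_not_dvd (Rat.HeightOneSpectrum.prime_natGenerator v)).mpr hv)
  have hone : ∀ v : HeightOneSpectrum (𝓞 ℚ), ¬ Rat.HeightOneSpectrum.natGenerator v ∣ N₀ →
      (1 : DirichletCharacter ℂ N₀) (Rat.HeightOneSpectrum.natGenerator v : ZMod N₀) = 1 := by
    intro v hv
    have hu : IsUnit (Rat.HeightOneSpectrum.natGenerator v : ZMod N₀) :=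
      (ZMod.isUnit_iff_coprime _ _).mpr
        ((Nat.Prime.coprime_iff_not_dvd (Rat.HeightOneSpectrum.prime_natGenerator v)).mpr hv)
    exact MulChar.one_apply hu
  have hsplit : ∀ v : HeightOneSpectrum (𝓞 ℚ), ¬ Rat.HeightOneSpectrum.natGenerator v ∣ N₀ →
      (∃ w₁ w₂ : HeightOneSpectrum (𝓞 K), w₁ ≠ w₂ ∧
        w₁.asIdeal.under (𝓞 ℚ) = v.asIdeal ∧ w₂.asIdeal.under (𝓞 ℚ) = v.asIdeal) →
      (1 : DirichletCharacter ℂ N₀) (Rat.HeightOneSpectrum.natGenerator v : ZMod N₀) *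
          (Rat.HeightOneSpectrum.natGenerator v : ℂ) ^ ((k : ℤ) - 1) =
        idealPow K ψ (Ideal.span {((Rat.HeightOneSpectrum.natGenerator v : ℕ) : 𝓞 K)}) := by
    intro v hv hpair
    rw [hone v hv, hψp v hv, hzpow]
    rcases exists_places_eq_pair_or_eq_singleton hK v (hunr v hv) with
      ⟨w₁, w₂, hne, hS, h₁, h₂⟩ | ⟨w, hS, hw⟩
    · rw [kroneckerChar_natGenerator_eq_one_of_pair hζ v hne hS h₁ h₂]
    · exfalso
      obtain ⟨w₁, w₂, hne, hw₁, hw₂⟩ := hpair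
      have h1 : w₁ ∈ ({w} : Set (HeightOneSpectrum (𝓞 K))) := by rw [← hS]; exact hw₁
      have h2 : w₂ ∈ ({w} : Set (HeightOneSpectrum (𝓞 K))) := by rw [← hS]; exact hw₂
      rw [Set.mem_singleton_iff] at h1 h2
      exact hne (h1.trans h2.symm)
  have hinert : ∀ v : HeightOneSpectrum (𝓞 ℚ), ¬ Rat.HeightOneSpectrum.natGenerator v ∣ N₀ →
      (∃ w : HeightOneSpectrum (𝓞 K), w.asIdeal.under (𝓞 ℚ) = v.asIdeal ∧
        w.asIdeal.inertiaDeg (𝓞 ℚ) = 2) →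
      (1 : DirichletCharacter ℂ N₀) (Rat.HeightOneSpectrum.natGenerator v : ZMod N₀) *
          (Rat.HeightOneSpectrum.natGenerator v : ℂ) ^ ((k : ℤ) - 1) =
        -idealPow K ψ (Ideal.span {((Rat.HeightOneSpectrum.natGenerator v : ℕ) : 𝓞 K)}) := by
    intro v hv hsing
    rw [hone v hv, hψp v hv, hzpow]
    rcases exists_places_eq_pair_or_eq_singleton hK v (hunr v hv) with
      ⟨w₁, w₂, hne, hS, h₁, h₂⟩ | ⟨w, hS, hw⟩
    · exfalso
      obtain ⟨w, hwv', hf⟩ := hsing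
      have hmem : w ∈ ({w₁, w₂} : Set (HeightOneSpectrum (𝓞 K))) := by rw [← hS]; exact hwv'
      rcases hmem with h | h
      · rw [h, h₁] at hf; norm_num at hf
      · rw [Set.mem_singleton_iff] at h; rw [h, h₂] at hf; norm_num at hf
    · rw [kroneckerChar_natGenerator_eq_neg_one_of_singleton hζ v hS hw]; ring
  -- the newform on `Γ₁`
  obtain ⟨M₀, hM₀ne, hM₀, g₂, hnew1, hpack, hchar⟩ :=
    exists_isNewform1_of_cm_qExpansion hK 𝔪 ψ hg0 hgχ hq' hunr hcop hsplit hinert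
  haveI := hM₀ne
  have hε : nebentypus g₂ = 1 := (DirichletCharacter.changeLevel_eq_one_iff hM₀).mp hchar
  -- descent to `Γ₀`
  obtain ⟨g₃, hnew0, hcoe₃⟩ :=
    Literature.NumberTheory.Automorphic.BCDT.exists_isNewform0_coe_eq_of_nebentypus_eq_one hnew1 hε
  have hlift : liftToGamma1 M₀ (k : ℤ) g₃ = g₂ :=
    DFunLike.coe_injective ((coe_liftToGamma1_holds M₀ (k : ℤ) g₃).trans hcoe₃)
  refine ⟨M₀, hM₀ne, g₃, hM₀, hnew0, ?_, fun p hp hpN => ?_⟩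
  · -- complex multiplication by `κ`
    rw [hlift]
    refine ⟨(discr K).natAbs, κ, ?_, ?_⟩
    · intro h1
      have := hodd
      rw [h1] at this
      change (1 : DirichletCharacter ℂ (discr K).natAbs) (-1) = -1 at this
      rw [MulChar.one_apply (isUnit_one.neg)] at this
      norm_num at this
    · rw [Filter.eventually_cofinite]
      refine (Nat.divisors N₀).finite_toSet.subset fun p hp => ?_
      simp only [Set.mem_setOf_eq, Classical.not_imp] at hp
      obtain ⟨hpp, hne⟩ := hp
      rw [Finset.mem_coe, Nat.mem_divisors]
      refine ⟨?_, NeZero.ne _⟩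
      by_contra hpN
      apply hne
      -- `p ∤ N₀`: read `p` as a place `v`
      obtain ⟨v, hv⟩ : ∃ v : HeightOneSpectrum (𝓞 ℚ), Rat.HeightOneSpectrum.natGenerator v = p :=
        ⟨(Rat.HeightOneSpectrum.primesEquiv (R := 𝓞 ℚ)).symm ⟨p, hpp⟩,
          congrArg Subtype.val ((Rat.HeightOneSpectrum.primesEquiv (R := 𝓞 ℚ)).apply_symm_apply _)⟩
      subst hv
      rw [IsNewform1.heckeEigenvalue_eq_coeff_holds hnew1 hpp]
      change κ _ * cuspCoeff g₂ _ = cuspCoeff g₂ _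
      rw [hpack _ hpp hpN]
      rcases exists_places_eq_pair_or_eq_singleton hK v (hunr v hpN) with
        ⟨w₁, w₂, hne', hS, h₁, h₂⟩ | ⟨w, hS, hw⟩
      · rw [kroneckerChar_natGenerator_eq_one_of_pair hζ v hne' hS h₁ h₂, one_mul]
      · rw [finsum_mem_setOf_absNorm_eq_of_singleton v hS hw, mul_zero]
  · -- the prime coefficients
    obtain ⟨v, hv⟩ : ∃ v : HeightOneSpectrum (𝓞 ℚ), Rat.HeightOneSpectrum.natGenerator v = p :=
      ⟨(Rat.HeightOneSpectrum.primesEquiv (R := 𝓞 ℚ)).symm ⟨p, hp⟩,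
        congrArg Subtype.val ((Rat.HeightOneSpectrum.primesEquiv (R := 𝓞 ℚ)).apply_symm_apply _)⟩
    subst hv
    have hc₃ : cuspCoeff g₃ (Rat.HeightOneSpectrum.natGenerator v) =
        cuspCoeff g₂ (Rat.HeightOneSpectrum.natGenerator v) := by
      simp only [cuspCoeff, hcoe₃]
    rw [hc₃, hpack _ hp hpN]
    change _ = ∑ᶠ w ∈ {w : HeightOneSpectrum (𝓞 K) |
      Ideal.absNorm w.asIdeal = Rat.HeightOneSpectrum.natGenerator v}, ψ w
    rcases exists_places_eq_pair_or_eq_singleton hK v (hunr v hpN) with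
      ⟨w₁, w₂, hne', hS, h₁, h₂⟩ | ⟨w, hS, hw⟩
    · have hm₁ : w₁ ∈ {w : HeightOneSpectrum (𝓞 K) | w.asIdeal.under (𝓞 ℚ) = v.asIdeal} := by
        rw [hS]; exact Set.mem_insert _ _
      have hm₂ : w₂ ∈ {w : HeightOneSpectrum (𝓞 K) | w.asIdeal.under (𝓞 ℚ) = v.asIdeal} := by
        rw [hS]; exact Set.mem_insert_of_mem _ rfl
      have hset : {w : HeightOneSpectrum (𝓞 K) |
          Ideal.absNorm w.asIdeal = Rat.HeightOneSpectrum.natGenerator v} = {w₁, w₂} := by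
        ext w
        have h := congrArg (fun S : Set (Ideal (𝓞 K)) => w.asIdeal ∈ S) (setOf_absNorm_eq_of_pair v hS h₁ h₂)
        simp only [Set.mem_setOf_eq, Set.mem_insert_iff, Set.mem_singleton_iff, eq_iff_iff] at h
        simp only [Set.mem_setOf_eq, Set.mem_insert_iff, Set.mem_singleton_iff]
        rw [h, HeightOneSpectrum.ext_iff, HeightOneSpectrum.ext_iff]
      rw [finsum_mem_setOf_absNorm_eq_of_pair v hne' hS h₁ h₂,
        rayClassCoeff_asIdeal_of_isCoprime _ _ (hcop v hpN w₁ hm₁),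
        rayClassCoeff_asIdeal_of_isCoprime _ _ (hcop v hpN w₂ hm₂), hset,
        finsum_mem_pair hne']
    · have hset : {w : HeightOneSpectrum (𝓞 K) |
          Ideal.absNorm w.asIdeal = Rat.HeightOneSpectrum.natGenerator v} = ∅ := by
        ext w'
        have h := congrArg (fun S : Set (Ideal (𝓞 K)) => w'.asIdeal ∈ S) (setOf_absNorm_eq_of_singleton v hS hw)
        simp only [Set.mem_setOf_eq, Set.mem_empty_iff_false, eq_iff_iff] at h
        simp only [Set.mem_setOf_eq, Set.mem_empty_iff_false, iff_false]
        exact fun h' => h.mp h'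
      rw [finsum_mem_setOf_absNorm_eq_of_singleton v hS hw, hset, finsum_mem_empty]

/-! ### Assembly: the named fact from the weight-`k` inputs, even `k ≥ 2` -/

/-- **`Ribet1977_cmNewform_gamma0_of_isGrossencharakter` (Ribet 1977 §3, Thm. (3.4)/Cor. (3.5),
trivial Nebentypus) VERBATIM, from ONE printed input per even weight `k ≥ 2`** — the hypothesis `Θ`:
for every imaginary quadratic `K`, `σ : K → ℂ`, even `k ≥ 2`, `𝔪 ≠ 0` and `ψ` the prime values of a
Größencharakter mod `𝔪` of type `σ^{k-1}` with `ψ̃((n)) = (d_K/n) n^{k-1}` for odd `n` prime to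
`|d_K| N𝔪`, THE WEIGHT-`k` HECKE THETA SERIES IS A CUSP FORM ON `Γ₀(|d_K|·N𝔪)`: some
`g ∈ S_k(Γ₀(|d_K|·N𝔪))` has `g(τ) = Σ_n (Σ_{N𝔞 = n, (𝔞,𝔪)=1} ψ̃(𝔞)) qⁿ` — Ribet's Thm. (3.4), first
sentence ("the series `g` is a cusp form of weight `k` and character `ε` on `Γ₁(DM)`", here
`ε = ηφ = 1`) = Shimura 1971, Lemma 3 = Hecke (theta series with the spherical polynomial `σ(x)^{k-1}`)
= Miyake, Thm. 4.8.2.  Odd `k` cannot occur (`even_weight_of_trivial_nebentypus`); every other step is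
`ribet1977_cmNewform_gamma0_of_heckeThetaCuspForm`.  The `k = 2` instance of `Θ` is the Summit-side
theorem `HeckeTheta.exists_heckeTheta_cuspForm` (not importable here).  This does NOT discharge the
named fact (the input is not in the tree for `k ≥ 4`); no summit statement is proved.
[cite: Ribet1977Nebentypus, §3, Thm. (3.4) and Cor. (3.5) (LNM 601, pp. 34–35)]
[cite: Shimura1971CMFactorsJacobians, Lemma 3] [cite: Miyake2006, Thm. 4.8.2] -/
theorem Ribet1977_cmNewform_gamma0_of_isGrossencharakter_of_heckeTheta
    (Θ : ∀ (K : Type) [Field K] [NumberField K], finrank ℚ K = 2 → IsTotallyComplex K →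
      ∀ (σ : K →+* ℂ) (k : ℕ), 2 ≤ k → Even k →
      ∀ (𝔪 : Ideal (𝓞 K)), 𝔪 ≠ ⊥ →
      ∀ (ψ : HeightOneSpectrum (𝓞 K) → ℂ),
        IsGrossencharakter 𝔪 (fun w => ((k : ℤ) - 1) * embType σ w)
          (fun w => ((k : ℤ) - 1) * embTypeConj σ w) ψ →
        (∀ n : ℕ, Odd n → n.Coprime ((discr K).natAbs * Ideal.absNorm 𝔪) →
          idealPow K ψ (Ideal.span {(n : 𝓞 K)}) = (jacobiSym (discr K) n : ℂ) * (n : ℂ) ^ (k - 1)) →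
        ∃ g : CuspForm (Gamma0 ((discr K).natAbs * Ideal.absNorm 𝔪)) (k : ℤ), ∀ τ : ℍ,
          HasSum (fun n : ℕ => (∑ᶠ J ∈ {J : Ideal (𝓞 K) | Ideal.absNorm J = n}, rayClassCoeff 𝔪 ψ J) *
            cexp (2 * π * I * (τ : ℂ)) ^ n) (g τ)) :
    Ribet1977_cmNewform_gamma0_of_isGrossencharakter := by
  intro K _ _ hK htc σ k hk 𝔪 h𝔪 ψ hψG hneb
  haveI := htc
  -- the weight is even
  have heven : Even k := even_weight_of_trivial_nebentypus hK σ (by omega) h𝔪 hψG hneb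
  exact ribet1977_cmNewform_gamma0_of_heckeThetaCuspForm K hK htc σ k hk 𝔪 h𝔪 ψ hψG hneb
    (Θ K hK htc σ k hk heven 𝔪 h𝔪 ψ hψG hneb)

end Literature.NumberTheory.EllipticCurves.ModularForms

end
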